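import Summits.QuantumFields.BalabanUV.Beta.D1BFx.TorusHodgeWeight
import Summits.QuantumFields.BalabanUV.Beta.D1BFx.TorusGaugeBasisMatrix
import Summits.QuantumFields.BalabanUV.Beta.D1BFx.RJetAssembly
import Literature.MathematicalPhysics.QuantumFieldTheory.Balaban1983to89.Beta.WilsonVertex2Sym

/-!
# `BalabanUV.Beta.D1BFx.CovariantLaplacianJets` — road «BF-x» for binder row D1, slot (K), X₃(ii) ROUTE T, owner row **«TB4-W» «THE WEIGHT
# JETS OF THE CANONICAL CO-FRAME»** (`HOME/b2b-balaban-beta-d1-p2/K-ASSEMBLY-SPEC-v2.md` v2.5 §3 (T3), owner ruling ρ-g6-12 (1), journal l.23228: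
# «ℤ⁴ jets of `D_U*` ∕ `D_U*D_U` under `U = exp(B)` to second order as tables — local, `ad`-linear»), PART 1 — THE `ℤ⁴` JETS OF THE COVARIANT
# GRADIENT `D_U`, OF ITS ADJOINT `D_U*` AND OF THE COVARIANT LAPLACIAN `L_U = D_U*D_U`, TO SECOND ORDER,
# as fibred kernels (`FibredPeriodisation.FKer`: sites = fibre `Unit`, bonds = fibre `Fin 4`) in the currency of `TorusGaugeBasisMatrix.dzF` ∕
# `TorusHodgeWeight.Dhat` ∕ `PeriodisedProjector.Lhat`, so that the zeroth order IS `TorusZerothJunction`'s datum `T₀ = NᵀL̂D̂ₛᵀ`, `A₀ = 2•(NᵀL̂L̂N)⁻¹`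

HONEST DEPENDENCY (cell records, verbatim): «continuum YM on T⁴ ⇐ BetaPertH ∧ nine spine estimates (0/9 proved); BetaPertH ⇐ (D1) ∧ (D4) ∧
CAP+tail; G-an2-4 gates asym, D1 and NE2/3/4.»  HONEST FRAMING (cell contract, verbatim): «discharging `BetaPertH` makes Bałaban's UV stability
UNCONDITIONAL — a real constructive-QFT result; it is NOT the continuum limit and NOT the Clay problem.»  THIS MODULE DISCHARGES NOTHING of (K),
of D1 or of the wall: [our object] data definitions (finite `ℤ⁴` stencils in closed form, asserting nothing) and [folklore] finite stencil algebra
over them — the product-rule DERIVATION of the stencils from the first jet `RJetAssembly.djMat` (leaf-05-g3, p212431) and the `U = 1` gradient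
`TorusGaugeBasisMatrix.dzF` (leaf-03-g8, p240579) BY NAME, the identification of the first Laplacian jet with the typer's ghost current
`GhostStencil.ghCur` (T6) through leaf-05-g3's pin `RJetAssembly.dJetSite_eq_ghCur`, and the zeroth order through gan24-leaf-06-g31's
`TorusHodgeWeight.sum_compKer_codiffKer_dzKer`.  No `def … : Prop`, nothing cited, no wall binder instantiated, 0 sorry.  0∕4 binders of row D1;
(K) NOT closed; NOT D1, NOT BetaPertH, NOT continuum, NOT Clay.

ABSOLUTE RULE (cell charter, verbatim): «No internally-minted statement may enter as a cited fact. Every hypothesis is either kernel-proved in this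
package or a verbatim quotation of a PUBLISHED theorem with page reference. The manuscript(s) under audit are NOT citable for their own disputed
steps — they are the thing under adjudication; programme-internal (2001/route/tribunal) claims are never citable.»

WHY (K-ASSEMBLY-SPEC v2.1 ∕ v2.5, ρ-g6-5, ρ-g6-12).  On ROUTE T the gauge-fixing weight of the N-side enters K-TA4G (R2) (`GramWeightJetsMixed.hessT_gramTransfer_jets`,
p240739) in CO-FRAME GRAM FORM `B(U) = T(U)ᵀA(U)T(U)` with `T(U) = NᵀL_U D_U*`, `A(U) = 2•(NᵀL_U L_U N)⁻¹` over a FIXED block-mean-free basis `N` (ρ-g6-12: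
`W ≡ W₀`, `W₁ = W₂ = 0`); the jets `T•`, `A•` are product-rule ∕ inverse jets of the jets of `D_U*` and `L_U`.  THIS FILE tabulates those jets ON `ℤ⁴`.

THE CONVENTION (stated once; consumed nowhere as a hypothesis; = `RJetAssembly` §2's pin + K-TA4C `ColourLift`'s lift).  Kernels are COLOUR-STRIPPED in
the plane model of the adjoint action: along the fine bond variable `a_b`, `Ad(U_b(s)) ↦ exp(s·a_b·C)` with ONE real antisymmetric `C`, `Cᵀ = −C`, `C² = −1`;
zeroth jets carry `1 ⊗`, first jets `C ⊗`, second jets `C² ⊗`.  Consequences used below as DEFINITIONS of the stripped tables: (i) every `s`-derivative of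
`(D_U λ)(x,α) = Ad(U_{x,α})λ(x+e_α) − λ(x)` at a single bond is the SAME shift table `djMat` (`exp` differentiates to itself), so the pure second jet
and the same-bond mixed jet of `D_U` are `djF` again and the cross-bond mixed jet of `D_U` is `0`; (ii) transposition flips the sign of FIRST jets only
(`(C⊗X)ᵀ = −C⊗Xᵀ`, `(C²⊗X)ᵀ = C²⊗Xᵀ`): `(D*)₁ = −trF djF`, `(D*)₂ = +trF djF`; (iii) in a product, a (first × first) monomial whose LEFT factor is a
transposed first jet carries `CᵀC = −C²`, i.e. the sign `−1` relative to the `C²` of the (second × zeroth) monomials.  This is the only place a sign lives.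
CHECK (displayed, not used): `⟨λ, L_Uλ⟩ = Σ_b |U_bλ(b₊) − λ(b₋)|²` depends on `U` only through `−2⟨λ(b₋), U_bλ(b₊)⟩`, whose `s²`-Taylor coefficient at
the bond `(κ,u)` is `−⟨λ(u), C²λ(u+e_κ)⟩` — the quadratic form of `−C² ⊗ (symmetric hop)`: §3's `lap₂ = −hop`.

CONTENT (`Site 4 = ℤ⁴`, bond `(x,α) = ⟨x, x+e_α⟩`, `e_α = AffineAveraging.unitVec α`; all [our object] defs are CLOSED-FORM finite stencils, the jet
DERIVATIONS are the theorems `…_eq_jets`):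
* §1 `djF κ u : FKer 4 (Fin 4) Unit` — the stripped first jet `Ḋ_{(κ,u)}` (`= djMat`, bond rows, site columns; `D₀ = dzF (d := 3)`); base ∕ column actions
  `tsum_mul_djMat_base`, `tsum_djMat_base_mul`, `tsum_dzKer_base_mul`; the four elementary compositions `D₀ᵀḊ`, `ḊᵀD₀`, `ḊᵀḊ′`, `D₀ᵀD₀` in closed form.
* §2 `lap₀` (`= lapKer`, **`compF_trF_dzF_dzF : D₀ᵀD₀ = lap₀`**), `lap₁ κ u` (`= ghCur κ u`, **`lap₁_eq_jets : lap₁ = D₀ᵀḊ − ḊᵀD₀`**).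
* §3 `lap₂ κ u` = MINUS the symmetric hop on the bond (pure second jet), **`lap₂_eq_jets : lap₂ = ḊᵀD₀ + D₀ᵀḊ − 2•ḊᵀḊ`**, `lap₂_eq_jets_sub_two_ghCnt`
  (T6's contact `ghCnt = ḊᵀḊ` is ONE monomial of it); the mixed jet `lap₁₁ κ u l u′` (**`lap₁₁_eq_jets`**: `[b=b′]•(ḊᵀD₀ + D₀ᵀḊ) − (ḊᵀḊ′ + Ḋ′ᵀḊ)`,
  `lap₁₁_self = lap₂`, cross-bond mixed jets VANISH `lap₁₁_of_ne`); parity types (`lap₁` antisymmetric, `lap₀`∕`lap₂` symmetric); translation covariance.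
* §4 sockets for periodisation: finitely supported rows (`Summable |row|`) of `djF`, `trF djF`, `trF dzF`, `lap₁`, `lap₂`, `lap₁₁`; `lap₀` jointly
  periodic with absolutely summable rows (`StencilKernels`).
NOT HERE: (PART 1b `CoframeFactorJets`) the co-frame factor `M(U) = L_U D_U*` and its jets `cof₀`∕`cof₁`∕`cof₁₁`; (PART 2 `TorusCoframeJets`) the torus
images, the `N`-sandwich `T• = Nᵀ M̂•`, the Gram jets `G• = Nᵀ(L̂²)•N`, the inverse jets `A•`, the junction with `TorusZerothJunction`; (PART 3) the
base-point ∕ array packing for TB5's limit socket.  NOT CLAIMED: TB4-tables (T1), (T2-kin), TB5.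
Provenance: D1 formalisation swarm, unit `b2b-balaban-beta-d1-formalise-leaf-03` (gen 9), claim «TB4-W» journal l.23490, 2026-08-20.
-/

noncomputable section

namespace Summit.QuantumFields.BalabanUV.Beta.D1BFx.CovariantLaplacianJets

open Literature.MathematicalPhysics.QuantumFieldTheory.Balaban1983to89
open Literature.MathematicalPhysics.QuantumFieldTheory.Balaban1983to89.Beta
open ExpKernelCalculus (Site)
open AffineAveraging (unitVec)
open B6QGQLower276 (lapKer lapKer_symm)
open WilsonVertex2Sym (ite_and_comm)
open Summit.QuantumFields.BalabanUV.Beta.D1BFx.FibredPeriodisation (FKer Kfib Kfib_apply compF)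
open Summit.QuantumFields.BalabanUV.Beta.D1BFx.SortedKernels (trF trF_apply)
open Summit.QuantumFields.BalabanUV.Beta.D1BFx.StencilKernels (dzKer codiffKer codiffKer_eq_dzKer_swap summable_dzKer_row summable_abs_lapKer_row
  isPeriodic₂_lapKer lapKer_translate)
open Summit.QuantumFields.BalabanUV.Beta.D1BFx.TorusGaugeBasisMatrix (dzF tsum_dzKer_mul summable_abs_dzF)
open Summit.QuantumFields.BalabanUV.Beta.D1BFx.TorusHodgeWeight (sum_compKer_codiffKer_dzKer)
open Summit.QuantumFields.BalabanUV.Beta.D1BFx.RJetAssembly (djMat tsum_djMat_mul dJetSite dJetSite_eq_ghCur add_unitVec_ne)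
open Summit.QuantumFields.BalabanUV.Beta.D1BFx.GhostStencil (ghCur ghCur_apply ghCnt ghCnt_apply ghCur_antisymm ghCur_translate unitVec_ne_zero)
open scoped BigOperators

variable (κ : Fin 4) (u : Site 4)

/-! ## §1 The stripped first jet `Ḋ` of the covariant gradient as a fibred kernel; elementary compositions -/

/-- [our object] **THE STRIPPED FIRST JET OF `D_U` ALONG THE FINE BOND `(κ, u)`** as a fibred kernel (rows = bonds `(x,α)`, columns = sites):
`djF κ u (x,α) (p,⋆) = RJetAssembly.djMat κ u x α p = [x = u][α = κ][p = u + e_κ]`.  By THE CONVENTION it is also the pure second jet and the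
same-bond mixed jet of `D_U`.  A definition; asserts nothing. -/
def djF (κ : Fin 4) (u : Site 4) : FKer 4 (Fin 4) Unit := fun i j => djMat κ u i.1 i.2 j.1

/-- [our object] Unfolding `djF`. -/
@[simp] theorem djF_apply (x : Site 4) (α : Fin 4) (p : Site 4) (b : Unit) :
    djF κ u (x, α) (p, b) = if x = u ∧ α = κ ∧ p = u + unitVec κ then (1 : ℝ) else 0 := rfl

/-- [our object] Unfolding `dzF` at `d = 3` (`TorusGaugeBasisMatrix.dzF`): `dzF (x,α) (w,⋆) = dzKer α x w = [w = x + e_α] − [w = x]`. -/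
theorem dzF_apply (x : Site 4) (α : Fin 4) (w : Site 4) (b : Unit) :
    dzF (d := 3) (x, α) (w, b) = (if w = x + unitVec α then (1 : ℝ) else 0) - (if w = x then 1 else 0) := rfl

/-- [folklore] BASE ACTION of `Ḋ`, table on the left (bond base summed; direction `β` and site `x` fixed):
`Σ'_w djMat κ u w β x · g w = [β = κ ∧ x = u + e_κ]·g u`. -/
theorem tsum_djMat_base_mul (β : Fin 4) (x : Site 4) (g : Site 4 → ℝ) :
    ∑' w, djMat κ u w β x * g w = if β = κ ∧ x = u + unitVec κ then g u else 0 := by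
  rw [tsum_eq_single u (fun w hw => by simp only [djMat]; rw [if_neg (fun h => hw h.1), zero_mul])]
  simp only [djMat, true_and]
  split_ifs <;> simp

/-- [folklore] BASE ACTION of `Ḋ`, table on the right: `Σ'_w g w · djMat κ u w β x = [β = κ ∧ x = u + e_κ]·g u`. -/
theorem tsum_mul_djMat_base (β : Fin 4) (x : Site 4) (g : Site 4 → ℝ) :
    ∑' w, g w * djMat κ u w β x = if β = κ ∧ x = u + unitVec κ then g u else 0 := by
  simp_rw [mul_comm (g _) _]
  exact tsum_djMat_base_mul κ u β x g

/-- [folklore] BASE ACTION of `D₀` (bond base summed): `Σ'_w dzKer β w x · g w = g (x − e_β) − g x`. -/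
theorem tsum_dzKer_base_mul (β : Fin 4) (x : Site 4) (g : Site 4 → ℝ) :
    ∑' w, dzKer β w x * g w = g (x - unitVec β) - g x := by
  have e : (fun w => dzKer β w x * g w) = fun w => (if w = x - unitVec β then g w else 0) - (if w = x then g w else 0) := by
    funext w
    have h1 : (x = w + unitVec β) ↔ (w = x - unitVec β) := by
      constructor <;> intro h
      · rw [h, add_sub_cancel_right]
      · rw [h, sub_add_cancel]
    simp only [dzKer, h1, @eq_comm _ x w]
    split_ifs <;> ring
  rw [e, Summable.tsum_sub, tsum_eq_single (x - unitVec β) (fun w hw => if_neg hw), if_pos rfl, tsum_eq_single x (fun w hw => if_neg hw),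
    if_pos rfl]
  · exact summable_of_ne_finset_zero (s := {x - unitVec β}) fun w hw => by
      rw [Finset.mem_singleton] at hw; rw [if_neg hw]
  · exact summable_of_ne_finset_zero (s := {x}) fun w hw => by
      rw [Finset.mem_singleton] at hw; rw [if_neg hw]

/-- [folklore] **`D₀ᵀḊ` IN CLOSED FORM**: `(trF dzF ∘ djF κ u) (x,⋆) (z,⋆) = [z = u + e_κ]·([x = u + e_κ] − [x = u])`. -/
theorem compF_trF_dzF_djF_apply (x z : Site 4) (a b : Unit) :
    compF (trF (dzF (d := 3))) (djF κ u) (x, a) (z, b)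
      = if z = u + unitVec κ then (if x = u + unitVec κ then (1 : ℝ) else 0) - (if x = u then 1 else 0) else 0 := by
  simp only [compF, trF_apply]
  have inner : ∀ β : Fin 4, ∑' w : Site 4, dzF (d := 3) (w, β) (x, a) * djF κ u (w, β) (z, b)
      = if β = κ ∧ z = u + unitVec κ then dzKer β u x else 0 := fun β =>
    tsum_mul_djMat_base κ u β z (fun w => dzKer β w x)
  simp only [inner]
  by_cases hz : z = u + unitVec κ
  · simp only [hz, and_true, Finset.sum_ite_eq', Finset.mem_univ, if_true]; rfl
  · simp only [hz, and_false, if_false, Finset.sum_const_zero]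

/-- [folklore] **`ḊᵀD₀` IN CLOSED FORM**: `(trF (djF κ u) ∘ dzF) (x,⋆) (z,⋆) = [x = u + e_κ]·([z = u + e_κ] − [z = u])`. -/
theorem compF_trF_djF_dzF_apply (x z : Site 4) (a b : Unit) :
    compF (trF (djF κ u)) (dzF (d := 3)) (x, a) (z, b)
      = if x = u + unitVec κ then (if z = u + unitVec κ then (1 : ℝ) else 0) - (if z = u then 1 else 0) else 0 := by
  simp only [compF, trF_apply]
  have inner : ∀ β : Fin 4, ∑' w : Site 4, djF κ u (w, β) (x, a) * dzF (d := 3) (w, β) (z, b)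
      = if β = κ ∧ x = u + unitVec κ then dzKer β u z else 0 := fun β =>
    tsum_djMat_base_mul κ u β x (fun w => dzKer β w z)
  simp only [inner]
  by_cases hx : x = u + unitVec κ
  · simp only [hx, and_true, Finset.sum_ite_eq', Finset.mem_univ, if_true]; rfl
  · simp only [hx, and_false, if_false, Finset.sum_const_zero]

/-- [folklore] **`ḊᵀḊ′` IN CLOSED FORM** (two bonds `(κ,u)`, `(l,u′)`): `(trF (djF κ u) ∘ djF l u′) (x,⋆) (z,⋆) = [x = u + e_κ]·[(κ,u) = (l,u′)]·[z = u′ + e_l]`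
— it VANISHES unless the two bonds coincide. -/
theorem compF_trF_djF_djF_apply (l : Fin 4) (u' : Site 4) (x z : Site 4) (a b : Unit) :
    compF (trF (djF κ u)) (djF l u') (x, a) (z, b)
      = if x = u + unitVec κ then (if u = u' ∧ κ = l ∧ z = u' + unitVec l then (1 : ℝ) else 0) else 0 := by
  simp only [compF, trF_apply]
  have inner : ∀ β : Fin 4, ∑' w : Site 4, djF κ u (w, β) (x, a) * djF l u' (w, β) (z, b)
      = if β = κ ∧ x = u + unitVec κ then djMat l u' u β z else 0 := fun β =>
    tsum_djMat_base_mul κ u β x (fun w => djMat l u' w β z)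
  simp only [inner]
  by_cases hx : x = u + unitVec κ
  · simp only [hx, and_true, Finset.sum_ite_eq', Finset.mem_univ, if_true]; rfl
  · simp only [hx, and_false, if_false, Finset.sum_const_zero]

/-! ## §2 Zeroth and first jets of the covariant Laplacian `L_U = D_U*D_U` -/

/-- [our object] **THE `U = 1` LAPLACIAN** as a fibred site kernel: `lap₀ (x,⋆) (z,⋆) = lapKer x z` (pv23's positive lattice Laplacian `dᵀd`,
the kernel periodised by `PeriodisedProjector.Lhat`).  A definition; asserts nothing. -/
def lap₀ : FKer 4 Unit Unit := fun i j => lapKer i.1 j.1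

/-- [our object] Unfolding `lap₀`. -/
@[simp] theorem lap₀_apply (x z : Site 4) (a b : Unit) : lap₀ (x, a) (z, b) = lapKer x z := rfl

/-- [folklore] **`D₀ᵀD₀ = lap₀`**: the zeroth jet of `D_U*D_U` is the positive Laplacian (`TorusHodgeWeight.sum_compKer_codiffKer_dzKer`, the swap
`codiffKer_eq_dzKer_swap`). -/
theorem compF_trF_dzF_dzF : compF (trF (dzF (d := 3))) (dzF (d := 3)) = lap₀ := by
  funext ⟨x, a⟩ ⟨z, b⟩
  rw [lap₀_apply, ← sum_compKer_codiffKer_dzKer]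
  simp only [compF, trF_apply, compKer]
  refine Finset.sum_congr rfl fun β _ => tsum_congr fun w => ?_
  rw [codiffKer_eq_dzKer_swap]
  rfl

/-- [our object] **THE STRIPPED FIRST JET OF `L_U = D_U*D_U` ALONG THE BOND `(κ,u)`** as a fibred site kernel, IN CLOSED FORM: the typer's
antisymmetric lattice current `GhostStencil.ghCur κ u` (`[x = u+e_κ][z = u] − [x = u][z = u+e_κ]`).  A definition; asserts nothing — that it IS the
jet is `lap₁_eq_jets`. -/
def lap₁ (κ : Fin 4) (u : Site 4) : FKer 4 Unit Unit := fun i j => ghCur κ u i.1 j.1 () ()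

/-- [our object] Unfolding `lap₁`. -/
@[simp] theorem lap₁_apply (x z : Site 4) (a b : Unit) : lap₁ κ u (x, a) (z, b) = ghCur κ u x z () () := rfl

/-- [folklore] `lap₁` is leaf-05-g3's site-level jet `dJetSite` read as a fibred kernel. -/
theorem lap₁_apply_eq_dJetSite (x z : Site 4) (a b : Unit) : lap₁ κ u (x, a) (z, b) = dJetSite κ u x z () () := by
  rw [lap₁_apply, dJetSite_eq_ghCur]

/-- [folklore] **THE FIRST-JET DERIVATION `lap₁ = D₀ᵀḊ − ḊᵀD₀`** (THE CONVENTION (ii): `(D*)₁ = −Ḋᵀ`; `= dJetSite = ghCur` by leaf-05-g3's pin). -/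
theorem lap₁_eq_jets : lap₁ κ u = compF (trF (dzF (d := 3))) (djF κ u) - compF (trF (djF κ u)) (dzF (d := 3)) := by
  funext ⟨x, a⟩ ⟨z, b⟩
  rw [Pi.sub_apply, Pi.sub_apply, compF_trF_dzF_djF_apply, compF_trF_djF_dzF_apply, lap₁_apply_eq_dJetSite]
  simp only [dJetSite]
  split_ifs <;> ring

/-- [folklore] PARITY TYPE: the first jet is ANTISYMMETRIC (`ghCur_antisymm`). -/
theorem lap₁_antisymm (x z : Site 4) (a b : Unit) : lap₁ κ u (z, b) (x, a) = -lap₁ κ u (x, a) (z, b) := by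
  rw [lap₁_apply, lap₁_apply, ghCur_antisymm]

/-- [folklore] The zeroth jet is symmetric (`lapKer_symm`). -/
theorem lap₀_symm (x z : Site 4) (a b : Unit) : lap₀ (z, b) (x, a) = lap₀ (x, a) (z, b) := by
  rw [lap₀_apply, lap₀_apply, lapKer_symm]

/-! ## §3 Second jets of `L_U`: the pure second jet `lap₂` (minus the hop) and the mixed jet `lap₁₁` -/

/-- [our object] **THE STRIPPED PURE SECOND JET OF `L_U` ALONG THE BOND `(κ,u)`**, IN CLOSED FORM: MINUS the symmetric hop across the bond,
`lap₂ κ u (x,⋆) (z,⋆) = −([x = u][z = u+e_κ] + [x = u+e_κ][z = u])`.  A definition; asserts nothing — that it IS the jet is `lap₂_eq_jets`. -/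
def lap₂ (κ : Fin 4) (u : Site 4) : FKer 4 Unit Unit := fun i j =>
  -((if i.1 = u ∧ j.1 = u + unitVec κ then (1 : ℝ) else 0) + (if i.1 = u + unitVec κ ∧ j.1 = u then (1 : ℝ) else 0))

/-- [our object] Unfolding `lap₂`. -/
@[simp] theorem lap₂_apply (x z : Site 4) (a b : Unit) : lap₂ κ u (x, a) (z, b)
    = -((if x = u ∧ z = u + unitVec κ then (1 : ℝ) else 0) + (if x = u + unitVec κ ∧ z = u then (1 : ℝ) else 0)) := rfl

/-- [folklore] **THE SECOND-JET DERIVATION `lap₂ = ḊᵀD₀ + D₀ᵀḊ − 2•ḊᵀḊ`** (THE CONVENTION: `D₂ = Ḋ`, `(D*)₂ = +Ḋᵀ` carry `C²`; the two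
(first × first) monomials `(D*)₁D₁ = −ḊᵀḊ` carry `CᵀC = −C²`). -/
theorem lap₂_eq_jets : lap₂ κ u
    = compF (trF (djF κ u)) (dzF (d := 3)) + compF (trF (dzF (d := 3))) (djF κ u) - (2 : ℝ) • compF (trF (djF κ u)) (djF κ u) := by
  funext ⟨x, a⟩ ⟨z, b⟩
  rw [Pi.sub_apply, Pi.sub_apply, Pi.add_apply, Pi.add_apply, Pi.smul_apply, Pi.smul_apply, smul_eq_mul,
    compF_trF_djF_dzF_apply, compF_trF_dzF_djF_apply, compF_trF_djF_djF_apply, lap₂_apply]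
  have hne := add_unitVec_ne u κ
  by_cases hx1 : x = u + unitVec κ <;> by_cases hx2 : x = u <;> by_cases hz1 : z = u + unitVec κ <;> by_cases hz2 : z = u
  all_goals (first | (exfalso; exact hne (hx1 ▸ hx2 ▸ rfl)) | (exfalso; exact hne (hz1 ▸ hz2 ▸ rfl)) | skip)
  all_goals simp only [hx1, hx2, hz1, hz2, if_true, if_false, and_true, and_false, and_self, hne, Ne.symm hne]
  all_goals norm_num

/-- [folklore] **RELATION TO T6's CONTACT**: `GhostStencil.ghCnt κ u = ḊᵀḊ` is ONE monomial of the second jet —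
`lap₂ = (ḊᵀD₀ + D₀ᵀḊ) − 2·ghCnt` entrywise (the typer kept the colour weight of `ghCnt` external; THE CONVENTION fixes it to `−2` relative to `C²`). -/
theorem lap₂_eq_jets_sub_two_ghCnt (x z : Site 4) (a b : Unit) : lap₂ κ u (x, a) (z, b)
    = (compF (trF (djF κ u)) (dzF (d := 3)) + compF (trF (dzF (d := 3))) (djF κ u)) (x, a) (z, b) - 2 * ghCnt κ u x z () () := by
  rw [Pi.add_apply, Pi.add_apply, compF_trF_djF_dzF_apply, compF_trF_dzF_djF_apply, lap₂_apply, ghCnt_apply]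
  have hne := add_unitVec_ne u κ
  by_cases hx1 : x = u + unitVec κ <;> by_cases hx2 : x = u <;> by_cases hz1 : z = u + unitVec κ <;> by_cases hz2 : z = u
  all_goals (first | (exfalso; exact hne (hx1 ▸ hx2 ▸ rfl)) | (exfalso; exact hne (hz1 ▸ hz2 ▸ rfl)) | skip)
  all_goals simp only [hx1, hx2, hz1, hz2, if_true, if_false, and_true, and_false, and_self, hne, Ne.symm hne]
  all_goals norm_num

/-- [folklore] PARITY TYPE: the pure second jet is SYMMETRIC. -/
theorem lap₂_symm (x z : Site 4) (a b : Unit) : lap₂ κ u (z, b) (x, a) = lap₂ κ u (x, a) (z, b) := by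
  rw [lap₂_apply, lap₂_apply, ite_and_comm (z = u) (x = u + unitVec κ), ite_and_comm (z = u + unitVec κ) (x = u), add_comm]

/-- [our object] **THE STRIPPED MIXED SECOND JET `∂ₛ∂ₜ L_U` ALONG TWO FINE BONDS `b = (κ,u)`, `b′ = (l,u′)`**, IN CLOSED FORM: `[b = b′]•lap₂ κ u`
— cross-bond mixed jets of the covariant Laplacian VANISH (no bond carries both variables).  A definition; asserts nothing — `lap₁₁_eq_jets`. -/
def lap₁₁ (κ : Fin 4) (u : Site 4) (l : Fin 4) (u' : Site 4) : FKer 4 Unit Unit :=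
  if u = u' ∧ κ = l then lap₂ κ u else 0

/-- [folklore] On the diagonal the mixed jet is the pure second jet. -/
theorem lap₁₁_self : lap₁₁ κ u κ u = lap₂ κ u := by
  rw [lap₁₁, if_pos ⟨rfl, rfl⟩]

/-- [folklore] **CROSS-BOND MIXED JETS VANISH.** -/
theorem lap₁₁_of_ne {l : Fin 4} {u' : Site 4} (h : ¬(u = u' ∧ κ = l)) : lap₁₁ κ u l u' = 0 := by
  rw [lap₁₁, if_neg h]

/-- [folklore] **THE MIXED-JET DERIVATION `lap₁₁ = [b = b′]•(ḊᵀD₀ + D₀ᵀḊ) − (ḊᵀḊ′ + Ḋ′ᵀḊ)`** (`D_st = [b=b′]•Ḋ`, `(D*)_st = [b=b′]•Ḋᵀ` with `C²`;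
`(D*)_sD_t + (D*)_tD_s = −(ḊᵀḊ′ + Ḋ′ᵀḊ)` with `CᵀC = −C²`; the latter vanishes off the diagonal by `compF_trF_djF_djF_apply`). -/
theorem lap₁₁_eq_jets (l : Fin 4) (u' : Site 4) : lap₁₁ κ u l u'
    = (if u = u' ∧ κ = l then compF (trF (djF κ u)) (dzF (d := 3)) + compF (trF (dzF (d := 3))) (djF κ u) else 0)
      - (compF (trF (djF κ u)) (djF l u') + compF (trF (djF l u')) (djF κ u)) := by
  by_cases h : u = u' ∧ κ = l
  · obtain ⟨rfl, rfl⟩ := h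
    rw [lap₁₁_self, if_pos ⟨rfl, rfl⟩, lap₂_eq_jets, two_smul]
  · rw [lap₁₁_of_ne κ u h, if_neg h, zero_sub]
    funext ⟨x, a⟩ ⟨z, b⟩
    have h' : ¬(u' = u ∧ l = κ) := fun hh => h ⟨hh.1.symm, hh.2.symm⟩
    simp only [Pi.zero_apply, Pi.neg_apply, Pi.add_apply, compF_trF_djF_djF_apply]
    rw [if_neg (show ¬(u = u' ∧ κ = l ∧ z = u' + unitVec l) from fun hh => h ⟨hh.1, hh.2.1⟩),
      if_neg (show ¬(u' = u ∧ l = κ ∧ z = u + unitVec κ) from fun hh => h' ⟨hh.1, hh.2.1⟩)]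
    simp only [ite_self, add_zero, neg_zero]

/-- [folklore] The mixed jet is symmetric in the two bond variables. -/
theorem lap₁₁_comm (l : Fin 4) (u' : Site 4) : lap₁₁ l u' κ u = lap₁₁ κ u l u' := by
  by_cases h : u = u' ∧ κ = l
  · obtain ⟨rfl, rfl⟩ := h; rfl
  · rw [lap₁₁_of_ne κ u h, lap₁₁_of_ne l u' (fun hh => h ⟨hh.1.symm, hh.2.symm⟩)]

/-- [folklore] PARITY TYPE: the mixed jet is SYMMETRIC as a kernel. -/
theorem lap₁₁_symm (l : Fin 4) (u' : Site 4) (x z : Site 4) (a b : Unit) :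
    lap₁₁ κ u l u' (z, b) (x, a) = lap₁₁ κ u l u' (x, a) (z, b) := by
  by_cases h : u = u' ∧ κ = l
  · obtain ⟨rfl, rfl⟩ := h
    rw [lap₁₁_self, lap₂_symm]
  · rw [lap₁₁_of_ne κ u h]; rfl

/-! ### Translation covariance (fine translations `v`) -/

/-- [folklore] `djF κ (u+v)` is `djF κ u` translated. -/
theorem djF_translate (v x : Site 4) (α : Fin 4) (p : Site 4) (b : Unit) :
    djF κ (u + v) (x + v, α) (p + v, b) = djF κ u (x, α) (p, b) := by
  simp only [djF_apply, add_left_inj, add_right_comm u v (unitVec κ)]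

/-- [folklore] `dzF` is translation invariant. -/
theorem dzF_translate (v x : Site 4) (α : Fin 4) (w : Site 4) (b : Unit) :
    dzF (d := 3) (x + v, α) (w + v, b) = dzF (d := 3) (x, α) (w, b) := by
  simp only [dzF_apply, add_left_inj, add_right_comm x v (unitVec α)]

/-- [folklore] `lap₀` is translation invariant. -/
theorem lap₀_translate (v x z : Site 4) (a b : Unit) : lap₀ (x + v, a) (z + v, b) = lap₀ (x, a) (z, b) := by
  rw [lap₀_apply, lap₀_apply, lapKer_translate]

/-- [folklore] `lap₁ κ (u+v)` is `lap₁ κ u` translated (`ghCur_translate`). -/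
theorem lap₁_translate (v x z : Site 4) (a b : Unit) : lap₁ κ (u + v) (x + v, a) (z + v, b) = lap₁ κ u (x, a) (z, b) := by
  rw [lap₁_apply, lap₁_apply, ghCur_translate]
  show ghCur κ u (x + v + -v) (z + v + -v) () () = _
  rw [add_neg_cancel_right, add_neg_cancel_right]

/-- [folklore] `lap₂ κ (u+v)` is `lap₂ κ u` translated. -/
theorem lap₂_translate (v x z : Site 4) (a b : Unit) : lap₂ κ (u + v) (x + v, a) (z + v, b) = lap₂ κ u (x, a) (z, b) := by
  simp only [lap₂_apply, add_left_inj, add_right_comm u v (unitVec κ)]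

/-- [folklore] `lap₁₁` is covariant under the simultaneous translation of both bonds and both sites. -/
theorem lap₁₁_translate (l : Fin 4) (u' v x z : Site 4) (a b : Unit) :
    lap₁₁ κ (u + v) l (u' + v) (x + v, a) (z + v, b) = lap₁₁ κ u l u' (x, a) (z, b) := by
  by_cases h : u = u' ∧ κ = l
  · obtain ⟨rfl, rfl⟩ := h
    rw [lap₁₁_self, lap₁₁_self, lap₂_translate]
  · rw [lap₁₁_of_ne κ u h, lap₁₁_of_ne κ (u + v) (fun hh => h ⟨add_right_cancel hh.1, hh.2⟩)]; rfl

/-! ## §4 Sockets for periodisation: finitely supported rows; the zeroth jet is jointly periodic with summable rows -/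

/-- [folklore] Rows of `djF` (a bond row, sites summed) are supported at one site. -/
theorem summable_abs_Kfib_djF (α : Fin 4) (b : Unit) (x : Site 4) : Summable fun y => |Kfib (djF κ u) α b x y| :=
  summable_of_ne_finset_zero (s := {u + unitVec κ}) fun y hy => by
    rw [Finset.mem_singleton] at hy
    rw [Kfib_apply, djF_apply, if_neg (fun h => hy h.2.2), abs_zero]

/-- [folklore] Rows of `Ḋᵀ = trF (djF κ u)` (a site row, bond bases summed) are supported at the base `u`. -/
theorem summable_abs_Kfib_trF_djF (b : Unit) (α : Fin 4) (x : Site 4) : Summable fun y => |Kfib (trF (djF κ u)) b α x y| :=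
  summable_of_ne_finset_zero (s := {u}) fun y hy => by
    rw [Finset.mem_singleton] at hy
    rw [Kfib_apply, trF_apply, djF_apply, if_neg (fun h => hy h.1), abs_zero]

/-- [folklore] Rows of `D₀ᵀ = trF dzF` are absolutely summable (two-point stencil in the base). -/
theorem summable_abs_Kfib_trF_dzF (b : Unit) (α : Fin 4) (x : Site 4) : Summable fun y => |Kfib (trF (dzF (d := 3))) b α x y| :=
  summable_of_ne_finset_zero (s := {x - unitVec α, x}) fun y hy => by
    simp only [Finset.mem_insert, Finset.mem_singleton, not_or] at hy
    rw [Kfib_apply, trF_apply, dzF_apply, if_neg (fun h => hy.1 (by rw [h, add_sub_cancel_right])), if_neg (Ne.symm hy.2), sub_zero, abs_zero]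

/-- [folklore] Rows of `lap₁` are supported on the bond `{u, u + e_κ}`. -/
theorem summable_abs_Kfib_lap₁ (a b : Unit) (x : Site 4) : Summable fun y => |Kfib (lap₁ κ u) a b x y| :=
  summable_of_ne_finset_zero (s := {u, u + unitVec κ}) fun y hy => by
    simp only [Finset.mem_insert, Finset.mem_singleton, not_or] at hy
    rw [Kfib_apply, lap₁_apply, ghCur_apply, if_neg (fun h => hy.1 h.2), if_neg (fun h => hy.2 h.2), sub_zero, abs_zero]

/-- [folklore] Rows of `lap₂` are supported on the bond `{u, u + e_κ}`. -/
theorem summable_abs_Kfib_lap₂ (a b : Unit) (x : Site 4) : Summable fun y => |Kfib (lap₂ κ u) a b x y| :=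
  summable_of_ne_finset_zero (s := {u, u + unitVec κ}) fun y hy => by
    simp only [Finset.mem_insert, Finset.mem_singleton, not_or] at hy
    rw [Kfib_apply, lap₂_apply, if_neg (fun h => hy.2 h.2), if_neg (fun h => hy.1 h.2), add_zero, neg_zero, abs_zero]

/-- [folklore] Rows of `lap₁₁` are absolutely summable. -/
theorem summable_abs_Kfib_lap₁₁ (l : Fin 4) (u' : Site 4) (a b : Unit) (x : Site 4) :
    Summable fun y => |Kfib (lap₁₁ κ u l u') a b x y| := by
  by_cases h : u = u' ∧ κ = l
  · obtain ⟨rfl, rfl⟩ := h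
    rw [lap₁₁_self]
    exact summable_abs_Kfib_lap₂ κ u a b x
  · rw [lap₁₁_of_ne κ u h]
    simp only [Kfib_apply, Pi.zero_apply, abs_zero]
    exact summable_zero

/-- [folklore] Rows of `lap₀` are absolutely summable (`StencilKernels.summable_abs_lapKer_row`). -/
theorem summable_abs_Kfib_lap₀ (a b : Unit) (x : Site 4) : Summable fun y => |Kfib lap₀ a b x y| :=
  summable_abs_lapKer_row x

/-- [folklore] `lap₀` is jointly `s`-periodic for every `s` (translation invariant; `StencilKernels.isPeriodic₂_lapKer`). -/
theorem isPeriodic₂_Kfib_lap₀ (s : ℕ) (a b : Unit) : IsPeriodic₂ s (Kfib lap₀ a b) :=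
  isPeriodic₂_lapKer s

end Summit.QuantumFields.BalabanUV.Beta.D1BFx.CovariantLaplacianJets

end
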